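import Summits.ResolutionOfSingularities.ResolutionOfSingularities.Theorems.SharpStrataSepExcModelsModelSpreadsFibres
import Literature.RingTheory.KrullDimension.AffineCatenary
import HarnessLib

/-!
# The residue field of a birational local model: dimension count and separability

Line `birth` of crux `SharpStrata.SepExcModels` (stmt-ResolutionOfSingularities-16828,
`Cruxes/SepExcModels/Lines/birth.lean`), lead c1, second helper file for the tool stub (T6,
ring form) `stub_sepAbhyankarPlace_of_model` (the converse of the valuative criterion).

Setting: `A` a finitely generated algebra over a field `k` with fraction field `K`, `R = A_P`
inside `K`, `B = R[s] ⊆ K` (`s` finite) and a prime `𝔮` of `B`; `S = B_𝔮`, with residue field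
`κ(S)`. Two facts about `κ(S)`:

* `exists_trdeg_residueField_add_eq` — **the dimension count**
  `tr.deg_k κ(S) + dim S = tr.deg_k K` (both sides natural numbers): `B` is the localisation of
  the affine domain `C = A[s]` (`ModelSpreads.isLocalization_adjoin`), so `S = C_Q` for
  `Q = 𝔮 ∩ C`, `dim S = ht Q`, `κ(S) = Frac(C/Q)`, and `dim C/Q + ht Q = dim C` (the dimension
  formula for affine domains, `Literature.RingTheory.KrullDimension.ringKrullDim_quotient_add_height`,
  Matsumura Thm. 5.6) with `dim = tr.deg` for affine domains
  (`exists_ringKrullDim_eq_and_trdeg_eq`).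
* `formallySmooth_residueField_of_model` — **separability**: if `𝔮` lies over `𝔪_R` and
  `(B/𝔮)[1/g]` is smooth over `κ(R)` for some `g ∉ 𝔮`, then `κ(S) = Frac((B/𝔮)[1/g])` is
  formally smooth over `κ(R)` (smooth, then a localisation).

## Sources

* H. Matsumura, *Commutative Ring Theory*, CUP 1986, Thm. 5.6 (dimension formula).
  [Matsumura1987]
* A. Benito, O. Piltant, A. J. Reguera, J. Pure Appl. Algebra 226 (2022) 107113, Lemma 4.2
  (the models). [BenitoPiltantReguera2022]
-/

noncomputable section

-- single-problem summit: the doubled namespace component `ResolutionOfSingularities` is forced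
set_option linter.dupNamespace false

open IsLocalRing
open Summit.ResolutionOfSingularities.ResolutionOfSingularities.Theorems.SepExcModels.ModelSpreads

namespace Summit.ResolutionOfSingularities.ResolutionOfSingularities.Theorems.SepExcModels.ModelValuationResidue

/-! ## The dimension count `tr.deg_k κ(B_𝔮) + dim B_𝔮 = tr.deg_k K` -/

/-- **Dimension count for a birational local model.** Let `A` be a finitely generated algebra
over a field `k` with fraction field `K`, `R = A_P ⊆ K`, `B = R[s] ⊆ K` with `s` finite, and
`𝔮` a prime of `B` with local ring `S = B_𝔮` (any localisation of `B` at `𝔮`, a `k`-algebra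
compatibly with `A`). Then there are natural numbers `n, e` with `tr.deg_k K = n`, `dim S = e`
and `tr.deg_k κ(S) + e = n`: with `C = A[s]` (an affine domain with `Frac C = K`, so
`dim C = tr.deg_k K`) and `Q = 𝔮 ∩ C` one has `S = C_Q` (`B` is a localisation of `C`),
`dim S = ht Q`, `κ(S) = Frac(C/Q)` and `dim C/Q + ht Q = dim C` (Matsumura Thm. 5.6).
[cite: Matsumura1987, Thm 5.6] -/
theorem exists_trdeg_residueField_add_eq {k A K R S : Type} [Field k] [CommRing A] [Algebra k A]
    [Algebra.FiniteType k A] [Field K] [Algebra k K] [Algebra A K] [IsScalarTower k A K]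
    [IsFractionRing A K] [CommRing R] [Algebra A R] [Algebra R K] [IsScalarTower A R K]
    (P : Ideal A) [P.IsPrime] [IsLocalization.AtPrime R P] (s : Finset K)
    (𝔮 : Ideal (Algebra.adjoin R (s : Set K))) [𝔮.IsPrime]
    [CommRing S] [IsLocalRing S] [Algebra (Algebra.adjoin R (s : Set K)) S]
    [IsLocalization.AtPrime S 𝔮] [Algebra A S] [IsScalarTower A (Algebra.adjoin R (s : Set K)) S]
    [Algebra k S] [IsScalarTower k A S] :
    ∃ n e : ℕ, Algebra.trdeg k K = n ∧ ringKrullDim S = e ∧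
      Algebra.trdeg k (ResidueField S) + e = n := by
  classical
  haveI : IsDomain A :=
    Function.Injective.isDomain (algebraMap A K) (IsFractionRing.injective A K)
  haveI : IsNoetherianRing A := Algebra.FiniteType.isNoetherianRing k A
  -- the affine model `C = A[s] ⊆ B = R[s]`
  have hCB : Algebra.adjoin A (s : Set K) ≤ (Algebra.adjoin R (s : Set K)).restrictScalars A :=
    Algebra.adjoin_le Algebra.subset_adjoin
  -- (the inclusion as `Subalgebra.inclusion` into the restriction of scalars: hand-rolled
  -- inclusions between these subalgebras are prohibitively slow to check in the kernel)
  letI algCB : Algebra (Algebra.adjoin A (s : Set K)) (Algebra.adjoin R (s : Set K)) :=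
    (Subalgebra.inclusion hCB).toRingHom.toAlgebra
  have halg : ∀ c : Algebra.adjoin A (s : Set K),
      (algebraMap (Algebra.adjoin A (s : Set K)) (Algebra.adjoin R (s : Set K)) c : K) = c :=
    fun c => Subalgebra.coe_inclusion hCB c
  haveI := IsScalarTower.of_algebraMap_eq (R := A) (S := Algebra.adjoin A (s : Set K))
    (A := Algebra.adjoin R (s : Set K)) fun a => Subtype.ext (by
      rw [halg, Subalgebra.coe_algebraMap, Subalgebra.coe_algebraMap])
  haveI hM : IsLocalization (Algebra.algebraMapSubmonoid (Algebra.adjoin A (s : Set K))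
      P.primeCompl) (Algebra.adjoin R (s : Set K)) := isLocalization_adjoin P.primeCompl _ halg
  -- `C → B → S`, `Q = 𝔮 ∩ C`, `S = C_Q`
  letI algCS : Algebra (Algebra.adjoin A (s : Set K)) S :=
    ((algebraMap (Algebra.adjoin R (s : Set K)) S).comp
      (algebraMap (Algebra.adjoin A (s : Set K)) (Algebra.adjoin R (s : Set K)))).toAlgebra
  haveI : IsScalarTower (Algebra.adjoin A (s : Set K)) (Algebra.adjoin R (s : Set K)) S :=
    IsScalarTower.of_algebraMap_eq fun _ => rfl
  set Q : Ideal (Algebra.adjoin A (s : Set K)) :=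
    𝔮.comap (algebraMap (Algebra.adjoin A (s : Set K)) (Algebra.adjoin R (s : Set K))) with hQ
  haveI hSQ : IsLocalization.AtPrime S Q :=
    IsLocalization.isLocalization_isLocalization_atPrime_isLocalization
      (Algebra.algebraMapSubmonoid (Algebra.adjoin A (s : Set K)) P.primeCompl) S 𝔮
  have hdimS : ringKrullDim S = Q.height := IsLocalization.AtPrime.ringKrullDim_eq_height Q S
  -- `C` is an affine domain with `Frac C = K`: `dim C = tr.deg_k C = tr.deg_k K = n`
  haveI : Algebra.FiniteType A (Algebra.adjoin A (s : Set K)) :=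
    (Subalgebra.fg_iff_finiteType _).mp (Subalgebra.fg_adjoin_finset s)
  haveI : Algebra.FiniteType k (Algebra.adjoin A (s : Set K)) :=
    Algebra.FiniteType.trans (S := A) inferInstance inferInstance
  haveI : FaithfulSMul (Algebra.adjoin A (s : Set K)) K :=
    (faithfulSMul_iff_algebraMap_injective _ K).mpr Subtype.val_injective
  haveI : IsFractionRing (Algebra.adjoin A (s : Set K)) K := by
    refine IsFractionRing.of_field (Algebra.adjoin A (s : Set K)) K fun z => ?_
    obtain ⟨a, b, -, rfl⟩ := IsFractionRing.div_surjective (A := A) z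
    exact ⟨algebraMap A _ a, algebraMap A _ b, by
      rw [← IsScalarTower.algebraMap_apply, ← IsScalarTower.algebraMap_apply]⟩
  obtain ⟨n, hnC, hntr⟩ :=
    Literature.RingTheory.KrullDimension.exists_ringKrullDim_eq_and_trdeg_eq k
      (Algebra.adjoin A (s : Set K))
  have hnK : Algebra.trdeg k K = n := by
    haveI : Algebra.IsAlgebraic (Algebra.adjoin A (s : Set K)) K :=
      IsLocalization.isAlgebraic K (nonZeroDivisors (Algebra.adjoin A (s : Set K)))
    rw [← trdeg_add_eq k (Algebra.adjoin A (s : Set K)) (A := K),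
      trdeg_eq_zero (R := Algebra.adjoin A (s : Set K)) (A := K), add_zero, hntr]
  -- `C/Q` is an affine domain: `dim C/Q = tr.deg_k (C/Q) = m`
  haveI : Algebra.FiniteType k (Algebra.adjoin A (s : Set K) ⧸ Q) :=
    Algebra.FiniteType.of_surjective (Ideal.Quotient.mkₐ k Q) (Ideal.Quotient.mkₐ_surjective k Q)
  obtain ⟨m, hmC, hmtr⟩ :=
    Literature.RingTheory.KrullDimension.exists_ringKrullDim_eq_and_trdeg_eq k
      (Algebra.adjoin A (s : Set K) ⧸ Q)
  -- the dimension formula: `m + ht Q = n`, and `ht Q = e` is finite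
  have hform := Literature.RingTheory.KrullDimension.ringKrullDim_quotient_add_height k Q
  rw [hmC, hnC] at hform
  have hle : (Q.height : WithBot ℕ∞) ≤ n := by
    rw [← hnC]
    exact Ideal.height_le_ringKrullDim_of_ne_top (Ideal.IsPrime.ne_top inferInstance)
  have hle' : Q.height ≤ n := by exact_mod_cast hle
  obtain ⟨e, he⟩ := ENat.ne_top_iff_exists.1 (ne_top_of_le_ne_top (ENat.coe_ne_top n) hle')
  rw [← he] at hform hdimS
  have hme : m + e = n := by exact_mod_cast hform
  refine ⟨n, e, hnK, hdimS, ?_⟩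
  -- `κ(S) = Frac(C/Q)`, so `tr.deg_k κ(S) = tr.deg_k (C/Q) = m`
  let α : Algebra.adjoin A (s : Set K) ⧸ Q →+* ResidueField S :=
    Ideal.Quotient.lift Q ((residue S).comp (algebraMap (Algebra.adjoin A (s : Set K)) S))
      fun c hc => by
        rw [RingHom.comp_apply, residue_eq_zero_iff]
        exact (IsLocalization.AtPrime.to_map_mem_maximal_iff S Q c).mpr hc
  have hα : ∀ c, α (Ideal.Quotient.mk Q c) = residue S (algebraMap _ S c) := fun c =>
    Ideal.Quotient.lift_mk Q _ _
  letI algα : Algebra (Algebra.adjoin A (s : Set K) ⧸ Q) (ResidueField S) := α.toAlgebra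
  have hαmap : ∀ x, algebraMap (Algebra.adjoin A (s : Set K) ⧸ Q) (ResidueField S) x = α x :=
    fun x => rfl
  haveI : IsScalarTower k (Algebra.adjoin A (s : Set K) ⧸ Q) (ResidueField S) := by
    refine IsScalarTower.of_algebraMap_eq (R := k) (S := Algebra.adjoin A (s : Set K) ⧸ Q)
      (A := ResidueField S) fun c => ?_
    rw [IsScalarTower.algebraMap_apply k (Algebra.adjoin A (s : Set K))
      (Algebra.adjoin A (s : Set K) ⧸ Q), Ideal.Quotient.algebraMap_eq, hαmap, hα,
      IsScalarTower.algebraMap_apply k A (Algebra.adjoin A (s : Set K)),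
      IsScalarTower.algebraMap_apply (Algebra.adjoin A (s : Set K)) (Algebra.adjoin R (s : Set K)) S,
      ← IsScalarTower.algebraMap_apply A (Algebra.adjoin A (s : Set K)) (Algebra.adjoin R (s : Set K)),
      ← IsScalarTower.algebraMap_apply A (Algebra.adjoin R (s : Set K)) S,
      ← IsScalarTower.algebraMap_apply k A S, IsScalarTower.algebraMap_apply k S (ResidueField S),
      ResidueField.algebraMap_eq]
  have hαinj : Function.Injective α := by
    rw [injective_iff_map_eq_zero]
    intro x hx
    obtain ⟨c, rfl⟩ := Ideal.Quotient.mk_surjective x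
    rw [hα, residue_eq_zero_iff, IsLocalization.AtPrime.to_map_mem_maximal_iff S Q c] at hx
    exact Ideal.Quotient.eq_zero_iff_mem.mpr hx
  haveI : FaithfulSMul (Algebra.adjoin A (s : Set K) ⧸ Q) (ResidueField S) :=
    (faithfulSMul_iff_algebraMap_injective _ _).mpr hαinj
  haveI : FaithfulSMul k (Algebra.adjoin A (s : Set K) ⧸ Q) :=
    (faithfulSMul_iff_algebraMap_injective k (Algebra.adjoin A (s : Set K) ⧸ Q)).mpr
      (algebraMap k _).injective
  haveI : IsFractionRing (Algebra.adjoin A (s : Set K) ⧸ Q) (ResidueField S) := by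
    refine IsFractionRing.of_field (Algebra.adjoin A (s : Set K) ⧸ Q) (ResidueField S) fun z => ?_
    obtain ⟨x, rfl⟩ := residue_surjective z
    obtain ⟨⟨c, u⟩, hcu⟩ := IsLocalization.surj Q.primeCompl x
    refine ⟨Ideal.Quotient.mk Q c, Ideal.Quotient.mk Q u, ?_⟩
    have hu0 : α (Ideal.Quotient.mk Q u) ≠ 0 := fun h0 =>
      u.2 (Ideal.Quotient.eq_zero_iff_mem.mp (hαinj (h0.trans (map_zero α).symm)))
    rw [hαmap, hαmap, eq_div_iff hu0, hα, hα, ← map_mul, hcu]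
  haveI : Algebra.IsAlgebraic (Algebra.adjoin A (s : Set K) ⧸ Q) (ResidueField S) :=
    IsLocalization.isAlgebraic (ResidueField S) (nonZeroDivisors (Algebra.adjoin A (s : Set K) ⧸ Q))
  rw [← trdeg_add_eq k (Algebra.adjoin A (s : Set K) ⧸ Q) (A := ResidueField S),
    trdeg_eq_zero (R := Algebra.adjoin A (s : Set K) ⧸ Q) (A := ResidueField S), add_zero, hmtr]
  exact_mod_cast hme

/-! ## Separability of `κ(B_𝔮)` over `κ(R)` -/

/-- **The residue field of a separable local model is formally smooth over `κ(R)`.** For a local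
ring `R`, an `R`-algebra `B`, a prime `𝔮` of `B` over `𝔪_R` and `g ∉ 𝔮` with `(B/𝔮)[1/g]`
smooth over `κ(R) = R/𝔪_R`: the residue field `κ(B_𝔮) = Frac(B/𝔮) = Frac((B/𝔮)[1/g])` is
formally smooth over `κ(R)` (a localisation of a smooth algebra), for the algebra structure
induced by `R → B → B_𝔮`. [cite: BenitoPiltantReguera2022, Lemma 4.2] -/
theorem formallySmooth_residueField_of_model {R B : Type} [CommRing R] [IsLocalRing R]
    [CommRing B] [Algebra R B] (𝔮 : Ideal B) [𝔮.IsPrime]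
    (hle : IsLocalRing.maximalIdeal R ≤ 𝔮.comap (algebraMap R B)) (g : B) (hg : g ∉ 𝔮)
    (hsm : @Algebra.Smooth (R ⧸ IsLocalRing.maximalIdeal R) _
      (Localization.Away (Ideal.Quotient.mk 𝔮 g)) _
      ((algebraMap _ (Localization.Away (Ideal.Quotient.mk 𝔮 g))).comp
        (Ideal.quotientMap 𝔮 (algebraMap R B) hle)).toAlgebra)
    (hRS : IsLocalRing.maximalIdeal R ≤
      (IsLocalRing.maximalIdeal (Localization.AtPrime 𝔮)).comap
        ((algebraMap B (Localization.AtPrime 𝔮)).comp (algebraMap R B))) :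
    @Algebra.FormallySmooth (R ⧸ IsLocalRing.maximalIdeal R)
      (IsLocalRing.ResidueField (Localization.AtPrime 𝔮)) _ _
      (Ideal.quotientMap (IsLocalRing.maximalIdeal (Localization.AtPrime 𝔮))
        ((algebraMap B (Localization.AtPrime 𝔮)).comp (algebraMap R B)) hRS).toAlgebra := by
  classical
  have ht0 : Ideal.Quotient.mk 𝔮 g ≠ 0 := fun h => hg (Ideal.Quotient.eq_zero_iff_mem.mp h)
  have hpow : Submonoid.powers (Ideal.Quotient.mk 𝔮 g) ≤ nonZeroDivisors (B ⧸ 𝔮) :=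
    powers_le_nonZeroDivisors_of_noZeroDivisors ht0
  haveI : IsDomain (Localization.Away (Ideal.Quotient.mk 𝔮 g)) :=
    IsLocalization.isDomain_localization hpow
  -- the given `κ(R)`-structure on `E = (B/𝔮)[1/g]`
  letI instLE : Algebra (R ⧸ maximalIdeal R) (Localization.Away (Ideal.Quotient.mk 𝔮 g)) :=
    ((algebraMap _ (Localization.Away (Ideal.Quotient.mk 𝔮 g))).comp
      (Ideal.quotientMap 𝔮 (algebraMap R B) hle)).toAlgebra
  haveI : Algebra.Smooth (R ⧸ maximalIdeal R) (Localization.Away (Ideal.Quotient.mk 𝔮 g)) := hsm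
  haveI hsmE : Algebra.FormallySmooth (R ⧸ maximalIdeal R)
      (Localization.Away (Ideal.Quotient.mk 𝔮 g)) := Algebra.Smooth.formallySmooth
  -- `κ(B_𝔮) = κ(𝔮) = Frac(B/𝔮)` is a localisation of `E`
  have hunit : IsUnit (algebraMap (B ⧸ 𝔮) 𝔮.ResidueField (Ideal.Quotient.mk 𝔮 g)) :=
    IsLocalization.map_units 𝔮.ResidueField
      ⟨Ideal.Quotient.mk 𝔮 g, mem_nonZeroDivisors_of_ne_zero ht0⟩
  letI algES : Algebra (Localization.Away (Ideal.Quotient.mk 𝔮 g)) 𝔮.ResidueField :=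
    (IsLocalization.Away.lift (S := Localization.Away (Ideal.Quotient.mk 𝔮 g))
      (Ideal.Quotient.mk 𝔮 g) hunit).toAlgebra
  have hES : ∀ x : B ⧸ 𝔮,
      algebraMap (Localization.Away (Ideal.Quotient.mk 𝔮 g)) 𝔮.ResidueField (algebraMap _ _ x) =
      algebraMap (B ⧸ 𝔮) 𝔮.ResidueField x :=
    fun x => IsLocalization.Away.lift_eq (S := Localization.Away (Ideal.Quotient.mk 𝔮 g))
      (Ideal.Quotient.mk 𝔮 g) hunit x
  haveI : IsScalarTower (B ⧸ 𝔮) (Localization.Away (Ideal.Quotient.mk 𝔮 g)) 𝔮.ResidueField :=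
    IsScalarTower.of_algebraMap_eq fun x => (hES x).symm
  haveI : IsFractionRing (Localization.Away (Ideal.Quotient.mk 𝔮 g)) 𝔮.ResidueField :=
    IsFractionRing.isFractionRing_of_isDomain_of_isLocalization
      (.powers (Ideal.Quotient.mk 𝔮 g)) _ _
  haveI hsmS : Algebra.FormallySmooth (Localization.Away (Ideal.Quotient.mk 𝔮 g))
      𝔮.ResidueField :=
    Algebra.FormallySmooth.of_isLocalization
      (nonZeroDivisors (Localization.Away (Ideal.Quotient.mk 𝔮 g)))
  -- the tower `κ(R) → E → κ(B_𝔮)`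
  letI algRS : Algebra (R ⧸ maximalIdeal R) 𝔮.ResidueField :=
    (Ideal.quotientMap (maximalIdeal (Localization.AtPrime 𝔮))
      ((algebraMap B (Localization.AtPrime 𝔮)).comp (algebraMap R B)) hRS).toAlgebra
  have key : ∀ r : R, algebraMap (R ⧸ maximalIdeal R) 𝔮.ResidueField (Ideal.Quotient.mk _ r) =
      algebraMap (Localization.Away (Ideal.Quotient.mk 𝔮 g)) 𝔮.ResidueField
        (algebraMap (R ⧸ maximalIdeal R) (Localization.Away (Ideal.Quotient.mk 𝔮 g))
          (Ideal.Quotient.mk _ r)) := by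
    intro r
    have h1 : algebraMap (R ⧸ maximalIdeal R) (Localization.Away (Ideal.Quotient.mk 𝔮 g))
        (Ideal.Quotient.mk _ r) = algebraMap (B ⧸ 𝔮) _
          (Ideal.Quotient.mk 𝔮 (algebraMap R B r)) :=
      congrArg (algebraMap (B ⧸ 𝔮) (Localization.Away (Ideal.Quotient.mk 𝔮 g)))
        (Ideal.quotientMap_mk (I := 𝔮) (f := algebraMap R B) (H := hle))
    rw [h1, hES, Ideal.algebraMap_quotient_residueField_mk,
      IsScalarTower.algebraMap_apply B (Localization.AtPrime 𝔮) 𝔮.ResidueField,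
      ResidueField.algebraMap_eq]
    exact congrArg (residue (Localization.AtPrime 𝔮))
      (RingHom.comp_apply (algebraMap B (Localization.AtPrime 𝔮)) (algebraMap R B) r)
  haveI : IsScalarTower (R ⧸ maximalIdeal R) (Localization.Away (Ideal.Quotient.mk 𝔮 g))
      𝔮.ResidueField := by
    refine IsScalarTower.of_algebraMap_eq fun x => ?_
    obtain ⟨r, rfl⟩ := Ideal.Quotient.mk_surjective x
    exact key r
  exact Algebra.FormallySmooth.comp (R ⧸ maximalIdeal R) (Localization.Away (Ideal.Quotient.mk 𝔮 g))
    𝔮.ResidueField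

end Summit.ResolutionOfSingularities.ResolutionOfSingularities.Theorems.SepExcModels.ModelValuationResidue

end
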